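import Summits.Ventures.CertifiedManyBodySolver.Theorems.M3x2EdgeSplitSymReplayOutRouteEtaK
import Summits.Ventures.CertifiedManyBodySolver.Theorems.M3x2EdgeSplitSymReplayOutRouteMFK
import HarnessLib

/-!
# SymReplay checker — WORD-LEVEL FACTOR ROWS × KRONECKER DOTS («ηκ»): the E-class enumerator `shareRFastMFηDKP` with the per-pair
dense dot replaced by the landed Kronecker dot, LIST-EQUAL to it

(team lb-sym, cell hub-lb; hub-lb-sym-eng-4 g4, 2026-08-28; ADDITIVE on hub-lb-sym-eng-3 g4's `…OutRouteEtaK` (keyed word sort + dense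
integer word-level rows + packed emission = the E-class enumerator of record `shareRFastMFηDKP`, p671866) and on this lineage's κ modules
`…PackedKron` / `…OutRouteMFK` (`mkKRow`, `kdotP`, `stepOptK`, `stepOptK_eq`, p669970 / p670682); nothing landed is touched.)

WHY (measured on REAL rows, hub-lb STATUS 2026-08-28 «κ ON REAL K-32 ROWS», hub-lb-sym-eng-4 g4): on the factor rows of the
stmt-Ventures-22024 object of the price sheet (lb-dual LOWRANK K-32, 157 components, entries ≤ 30 bits, dense) the landed Kronecker dot
costs 7.0 µs per dot against 19.8 µs for the dense `zipWith/sum` dot (product-weighted over the component ranks, r̄ = 102.6; interpreted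
`#eval` = gate mode), i.e. ≈ −8 µs of the ≈ 38 µs per R-product of the η grammar — the largest single item left in the E₁ module body.
The κ enumerator of record (`shareRFastMFK`) dots ELEMENT rows; the η grammar dots WORD-LEVEL rows (`dgroupDK` tables).  This module is the
composition: η tables unchanged, each table row Kronecker-ENCODED ONCE and ONE-SIDED (`mkKRowL` = little-endian packing for representative rows, `mkKRowH` =
big-endian packing by one native left fold for basis rows — `kdotP` reads only `lo` of its first and `hi` of its second argument,
`kdotP_mkKRowLH`; offset `M` and digit width `b` read off the two tables BY CONSTRUCTION — `tabAbsBound`, `tabBits`), per-pair step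
`stepOptK` (one big-integer product + shift + mask).

WHAT.  Executables `tabAbsBound/tabBits/evalLEoff/evalBEoff/mkKRowL/mkKRowH/ptagK/rowFastFηκP/shareRWithMFηκKP/shareRFastMFηκKP`; the bridge **`shareRFastMFηκKP_eq :
shareRFastMFηκKP … = shareRFastMFηDKP …`** (LIST equality, every argument, no hypothesis: per pair `stepOptK_eq` — the Kronecker dot IS
the dense dot on rows of the tables' common length `colBoundR` with `|entry| < M` and `colBoundR·(2M−1)² < 2^b`, all three by
construction: `dgroupDK_length`, `abs_lt_tabAbsBound`, `tabBits_spec`); the closing **`energyDensity_ge_of_outroutePMFηκKP`** with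
`energyDensity_ge_of_outroutePMFηDKP`'s binder list EXACTLY (no new side fact).  MODULE GRAMMAR (E-class, hierarchical coarse routing): per
module `m < J·L` one file `out_m : PackedNF.pisZero (PackedNF.pcanonNFZHBZ lo hi oP (shareRFastMFηκKP momSpecC cert gbs tabC κ₂ lo hi J L
(m / L) (m % L))) = true := by native_decide` (or its `…T` ordered-map form via `pisZero_of_T`); globals `hC : intCoefOK …`, `hwf`, `hRok`,
`hbox`, `hcov`; close with `energyDensity_ge_of_outroutePMFηκKP`.  Standard axioms; no `native_decide` in this file.

HONEST FRAMING: an interpreted replay-COST lever (composition of two landed levers) with its equality proofs; certifies nothing; no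
bound of record moves; tree floor (8,⅞,0) −0.8942613047 (rung V, computational) unchanged; #529 −0.8295699476 outside Lean;
`LowerEdge_ge_m83o100` met BY VALUE only, un-landed; no summit or crux statement is proved here; nothing here predicts superconductivity.
-/

namespace Summit.Ventures.CertifiedManyBodySolver.Theorems.SymReplay

open Literature.MathematicalPhysics.QuantumLattice
open Literature.MathematicalPhysics.QuantumLattice.HubbardWave0
open Literature.MathematicalPhysics.QuantumLattice.ThermodynamicLimit
open Literature.Probability.LatticeModels
open Literature.MathematicalPhysics.QuantumManyBody.StateRelaxation
open Summit.Ventures.CertifiedManyBodySolver.Theorems.WardSlot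

/-! ##### (a) per-table Kronecker constants, by construction -/

/-- One more than the largest `|entry|` over a table of dense integer rows, folded from the start value `m`. -/
def tabAbsBound (L : List (List ℤ × (ℚ × Word))) (m : ℤ) : ℤ :=
  L.foldl (fun m y => y.1.foldl (fun m x => max m (|x| + 1)) m) m

/-- Digit width `b` with `n · (2M−1)² < 2^b`. -/
def tabBits (n : ℕ) (Mo : ℤ) : ℕ := Nat.log2 (n * (2 * Mo - 1).toNat * (2 * Mo - 1).toNat) + 1

/-- The defining inequality of `tabBits`. -/
theorem tabBits_spec (n : ℕ) (Mo : ℤ) : n * (2 * Mo - 1).toNat * (2 * Mo - 1).toNat < 2 ^ tabBits n Mo := Nat.lt_log2_self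

/-- Little-endian Kronecker number of the OFFSET digits, fused (no intermediate digit list): `Σᵢ (uᵢ + M)·X^i`. -/
def evalLEoff (X : ℕ) (M : ℤ) : List ℤ → ℕ
  | [] => 0
  | x :: xs => (x + M).toNat + X * evalLEoff X M xs

/-- Big-endian Kronecker number of the offset digits by ONE native left fold: `Σᵢ (uᵢ + M)·X^(r−1−i)`. -/
def evalBEoff (X : ℕ) (M : ℤ) (u : List ℤ) : ℕ := u.foldl (fun acc x => acc * X + (x + M).toNat) 0

/-- **Rep-side Kronecker row** (only the little-endian packing and the entry sum are read by `kdotP` on its FIRST argument). -/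
def mkKRowL (b : ℕ) (M : ℤ) (u : List ℤ) : KRow := ⟨evalLEoff (2 ^ b) M u, 0, u.sum⟩

/-- **Basis-side Kronecker row** (only the big-endian packing and the entry sum are read by `kdotP` on its SECOND argument). -/
def mkKRowH (b : ℕ) (M : ℤ) (u : List ℤ) : KRow := ⟨0, evalBEoff (2 ^ b) M u, u.sum⟩

/-- The fused little-endian encoder is `evalLE ∘ offDigits`. -/
theorem evalLEoff_eq (X : ℕ) (M : ℤ) : ∀ (u : List ℤ), evalLEoff X M u = evalLE X (offDigits M u)
  | [] => rfl
  | x :: xs => by rw [evalLEoff, evalLEoff_eq X M xs]; rfl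

/-- `evalLE` of a snoc: the new digit is the most significant. -/
theorem evalLE_append_singleton (X : ℕ) : ∀ (ds : List ℕ) (d : ℕ), evalLE X (ds ++ [d]) = evalLE X ds + d * X ^ ds.length
  | [], d => by simp [evalLE]
  | d' :: ds, d => by
    rw [List.cons_append, evalLE, evalLE, evalLE_append_singleton X ds d, List.length_cons, pow_succ]; ring

/-- The native left fold is `evalLE` of the REVERSED offset digits (general accumulator). -/
theorem foldl_horner_eq (X : ℕ) (M : ℤ) : ∀ (u : List ℤ) (a : ℕ),
    u.foldl (fun acc x => acc * X + (x + M).toNat) a = a * X ^ u.length + evalLE X (offDigits M u).reverse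
  | [], a => by simp [evalLE, offDigits]
  | x :: xs, a => by
    rw [List.foldl_cons, foldl_horner_eq X M xs, List.length_cons, pow_succ]
    have hrev : (offDigits M (x :: xs)).reverse = (offDigits M xs).reverse ++ [(x + M).toNat] := by
      simp [offDigits, List.map_cons, List.reverse_cons]
    rw [hrev, evalLE_append_singleton, List.length_reverse]
    simp only [offDigits, List.length_map]
    ring

/-- The fused big-endian encoder is `evalLE ∘ reverse ∘ offDigits`. -/
theorem evalBEoff_eq (X : ℕ) (M : ℤ) (u : List ℤ) : evalBEoff X M u = evalLE X (offDigits M u).reverse := by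
  rw [evalBEoff, foldl_horner_eq]; simp

/-- **The one-sided rows give the same Kronecker dot as the landed two-sided `mkKRow`** (`kdotP` reads `lo` of its first and
`hi` of its second argument only). -/
theorem kdotP_mkKRowLH (sh mask : ℕ) (M : ℤ) (r b : ℕ) (u v : List ℤ) :
    kdotP sh mask M r (mkKRowL b M u) (mkKRowH b M v) = kdotP sh mask M r (mkKRow b M u) (mkKRow b M v) := by
  simp only [kdotP, mkKRowL, mkKRowH, mkKRow, evalLEoff_eq, evalBEoff_eq]

/-- `stepOptK` on one-sided rows = `stepOptK` on two-sided rows. -/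
theorem stepOptK_mkKRowLH (sh mask : ℕ) (M : ℤ) (r b : ℕ) (u : List ℤ) (kb : ℚ) (t : ℚ × Word) (v : List ℤ) (cw : ℚ × Word) :
    stepOptK sh mask M r (mkKRowL b M u) kb t (mkKRowH b M v, cw) = stepOptK sh mask M r (mkKRow b M u) kb t (mkKRow b M v, cw) := by
  unfold stepOptK; rw [kdotP_mkKRowLH]

/-- The inner `max (|·|+1)` fold over a dense row dominates its start value. -/
theorem le_foldl_maxAbsZ (r : List ℤ) : ∀ m : ℤ, m ≤ r.foldl (fun m x => max m (|x| + 1)) m := by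
  induction r with
  | nil => intro m; exact le_rfl
  | cons x r ih => intro m; exact le_trans (le_max_left _ _) (ih _)

/-- Every entry of a dense row is strictly below the row's `max (|·|+1)` fold. -/
theorem abs_lt_foldl_maxAbsZ (r : List ℤ) : ∀ (m : ℤ), ∀ x ∈ r, |x| < r.foldl (fun m x => max m (|x| + 1)) m := by
  induction r with
  | nil => intro m x hx; simp at hx
  | cons x' r ih =>
    intro m x hx
    rw [List.foldl_cons]
    rcases List.mem_cons.1 hx with rfl | hx
    · exact lt_of_lt_of_le (lt_of_lt_of_le (lt_add_one _) (le_max_right _ _)) (le_foldl_maxAbsZ r _)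
    · exact ih _ x hx

/-- The table fold dominates its start value. -/
theorem le_tabAbsBound (L : List (List ℤ × (ℚ × Word))) : ∀ m : ℤ, m ≤ tabAbsBound L m := by
  induction L with
  | nil => intro m; exact le_rfl
  | cons y L ih => intro m; exact le_trans (le_foldl_maxAbsZ y.1 m) (ih _)

/-- **Every entry of every row of the table is strictly below `tabAbsBound` in absolute value.** -/
theorem abs_lt_tabAbsBound (L : List (List ℤ × (ℚ × Word))) :
    ∀ (m : ℤ), ∀ y ∈ L, ∀ x ∈ y.1, |x| < tabAbsBound L m := by
  induction L with
  | nil => intro m y hy; simp at hy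
  | cons y' L ih =>
    intro m y hy x hx
    show |x| < tabAbsBound L (y'.1.foldl (fun m x => max m (|x| + 1)) m)
    rcases List.mem_cons.1 hy with rfl | hy
    · exact lt_of_lt_of_le (abs_lt_foldl_maxAbsZ y.1 m x hx) (le_tabAbsBound L _)
    · exact ih _ y hy x hx

/-- Keyed dense word-level rows have the table width `n` (unconditionally; twin of `dgroupD_length`). -/
theorem dgroupDK_length {lo hi : ℤ × ℤ} {n : ℕ} {L : List (List (ℤ × ℕ) × (ℚ × Word))} {yD : List ℤ × (ℚ × Word)}
    (h : yD ∈ dgroupDK lo hi n L) : yD.1.length = n := by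
  rw [dgroupDK, List.mem_filterMap] at h
  obtain ⟨ch, -, hy⟩ := h
  cases ch with
  | nil => exact absurd hy (by simp [dheadD])
  | cons y ys =>
    simp only [dheadD, Option.some.injEq] at hy
    rw [← hy, daccZ_toList, List.length_map, List.length_range]

/-- **A table row meets the hypotheses of `kdot_mkKRow`** for any offset at least the table's bound: length `n`, entries in `[−M, M)`. -/
theorem dgroupDK_spec {lo hi : ℤ × ℤ} {n : ℕ} {L : List (List (ℤ × ℕ) × (ℚ × Word))} (Mo : ℤ) (m : ℤ)
    (hM : tabAbsBound (dgroupDK lo hi n L) m ≤ Mo) {yD : List ℤ × (ℚ × Word)} (h : yD ∈ dgroupDK lo hi n L) :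
    yD.1.length = n ∧ ∀ x ∈ yD.1, -Mo ≤ x ∧ x < Mo := by
  refine ⟨dgroupDK_length h, fun x hx => ?_⟩
  have := lt_of_lt_of_le (abs_lt_tabAbsBound _ m yD h x hx) hM
  rw [abs_lt] at this
  exact ⟨this.1.le, this.2⟩

/-! ##### (b) the ηκ enumerator (executables) -/

section EtaKron

variable {M : Type} [DecidableEq M] [Hashable M]

/-- Tag a dense word-level basis row `(σ̃_w, (1, w))` with its (basis-side) Kronecker row and the packed basis word (both computed ONCE per row). -/
def ptagK (lo hi : ℤ × ℤ) (b : ℕ) (Mo : ℤ) (x : List ℤ × (ℚ × Word)) : (KRow × (ℚ × Word)) × PackedNF.PWord :=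
  ((mkKRowH b Mo x.1, x.2), PackedNF.encW lo hi x.2.2)

/-- **One word-level representative row (Kronecker-encoded), PACKED emission**: `uP := encW lo hi u` once; per target the bucket of
`mt − mom u`, the secondary test on the product word first, then `stepOptK` (shift and mask hoisted per block), emitted as `(coef, uP ++ wP)`. -/
def rowFastFηκP (S : MomSpec M) (lo hi : ℤ × ℤ) (sh mask : ℕ) (Mo : ℤ) (n : ℕ) (y : KRow × (ℚ × Word))
    (wmapK : Std.HashMap M (List ((KRow × (ℚ × Word)) × PackedNF.PWord))) (kb : ℚ) (T : List M) (P₂ : Word → Bool) :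
    PackedNF.PPoly :=
  let uP := PackedNF.encW lo hi y.2.2
  T.flatMap fun mt =>
    (wmapK.getD (S.sub mt (mom S y.2.2)) []).filterMap fun xp =>
      if P₂ (y.2.2 ++ xp.1.2.2) then (stepOptK sh mask Mo n y.1 kb y.2 xp.1).map fun r => (r.1, uP ++ xp.2) else none

/-- **ENGINE ηκ R-part of sub-module `(i, f)`**: per block the two keyed dense word-level tables (as `shareRWithMFηDKP`), the offset
`M` and digit width `b` READ OFF THE TABLES, every row Kronecker-encoded once, one tagged bucket map, one `rowFastFηκP` per
representative row. -/
def shareRWithMFηκKP (S : MomSpec M) (lo hi : ℤ × ℤ) (K : SymCertR) (gbs : List (List QPoly)) (T : List M)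
    (P₂ : Word → Bool) : PackedNF.PPoly :=
  (K.gramR.zip gbs).flatMap fun Bg =>
    let n := colBoundR Bg.1
    let D := blockDen Bg.1
    let rz := blockRowsZ Bg.1
    let kb : ℚ := -1 * ((Bg.1.moves.length : ℚ) * Bg.1.scale) / ((D : ℚ) * D)
    let reps := dgroupDK lo hi n (tagRep (Bg.1.reps.zip rz))
    let bas := dgroupDK lo hi n (wflatZ (Bg.2.zip rz))
    let Mo := tabAbsBound reps (tabAbsBound bas 1)
    let b := tabBits n Mo
    let wmapK := bucketBy (fun xp : (KRow × (ℚ × Word)) × PackedNF.PWord => mom S xp.1.2.2) (bas.map (ptagK lo hi b Mo))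
    (reps.map fun y => (mkKRowL b Mo y.1, y.2)).flatMap fun y =>
      rowFastFηκP S lo hi (b * (n - 1)) (2 ^ b - 1) Mo n y wmapK kb T P₂

/-- **ENGINE ηκ sub-module share, PACKED at emission** — the function an E-class module file evaluates (base and `gramM` parts as
`shareRFastMFηDKP`). -/
def shareRFastMFηκKP (S : MomSpec M) (K : SymCertR) (gbs : List (List QPoly)) (hm : MomTable M) (κ₂ : Word → ℕ)
    (lo hi : ℤ × ℤ) (J L i f : ℕ) : PackedNF.PPoly :=
  let P := wordPred (inSlotW (momKey S hm) J i)
  let P₂ : Word → Bool := fun w => κ₂ w % L == f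
  PackedNF.encP lo hi ((baseShareF K.toSymCert P).filter (wordPred P₂)) ++
  (PackedNF.encP lo hi ((pscale (-1) (K.gramM.flatMap fun B => (gramBlockPoly B).filter P)).filter (wordPred P₂)) ++
    shareRWithMFηκKP S lo hi K gbs (targetsM hm J i) P₂)

/-! ##### (c) the list bridge to `shareRFastMFηDKP` and the closing -/

/-- Buckets of the Kronecker-tagged table are the dense-tagged buckets, re-tagged. -/
theorem bucketBy_map_ptagK (S : MomSpec M) (lo hi : ℤ × ℤ) (b : ℕ) (Mo : ℤ) (xs : List (List ℤ × (ℚ × Word))) (k : M) :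
    (bucketBy (fun xp : (KRow × (ℚ × Word)) × PackedNF.PWord => mom S xp.1.2.2) (xs.map (ptagK lo hi b Mo))).getD k [] =
      ((xs.filter fun x => decide (mom S x.2.2 = k)).reverse).map (ptagK lo hi b Mo) := by
  rw [bucketBy_getD, List.filter_map, List.map_reverse]
  rfl

/-- **Row bridge**: on rows of a table meeting the constructive hypotheses, the Kronecker row enumeration IS the dense one. -/
theorem rowFastFηκP_eq (S : MomSpec M) (lo hi : ℤ × ℤ) (b : ℕ) (Mo : ℤ) (n : ℕ)
    (hb : n * (2 * Mo - 1).toNat * (2 * Mo - 1).toNat < 2 ^ b) (y : List ℤ × (ℚ × Word))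
    (hy : y.1.length = n ∧ ∀ x ∈ y.1, -Mo ≤ x ∧ x < Mo) (bas : List (List ℤ × (ℚ × Word)))
    (hbas : ∀ x ∈ bas, x.1.length = n ∧ ∀ z ∈ x.1, -Mo ≤ z ∧ z < Mo) (kb : ℚ) (T : List M) (P₂ : Word → Bool) :
    rowFastFηκP S lo hi (b * (n - 1)) (2 ^ b - 1) Mo n (mkKRowL b Mo y.1, y.2)
        (bucketBy (fun xp : (KRow × (ℚ × Word)) × PackedNF.PWord => mom S xp.1.2.2) (bas.map (ptagK lo hi b Mo))) kb T P₂ =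
      rowFastFηDP S lo hi y
        (bucketBy (fun xp : (List ℤ × (ℚ × Word)) × PackedNF.PWord => mom S xp.1.2.2) (bas.map (ptagD lo hi))) kb T P₂ := by
  unfold rowFastFηκP rowFastFηDP
  refine List.flatMap_congr fun mt _ => ?_
  rw [bucketBy_map_ptagK, bucketBy_map_ptagD, bucketBy_getD, List.filterMap_map, List.filterMap_map]
  refine List.filterMap_congr fun x hx => ?_
  have hxb : x ∈ bas := (List.mem_filter.1 (List.mem_reverse.1 hx)).1
  simp only [Function.comp_apply, ptagK, ptagD]
  rw [stepOptK_mkKRowLH, stepOptK_eq b Mo n hb y.1 hy kb y.2 x (hbas x hxb)]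

/-- **R-part bridge: ηκ = ηDK** (list equality, every argument). -/
theorem shareRWithMFηκKP_eq (S : MomSpec M) (lo hi : ℤ × ℤ) (K : SymCertR) (gbs : List (List QPoly)) (T : List M)
    (P₂ : Word → Bool) : shareRWithMFηκKP S lo hi K gbs T P₂ = shareRWithMFηDKP S lo hi K gbs T P₂ := by
  unfold shareRWithMFηκKP shareRWithMFηDKP
  refine List.flatMap_congr fun Bg _ => ?_
  dsimp only
  rw [PackedNF.flatMap_map_left]
  refine List.flatMap_congr fun y hy => ?_
  set n := colBoundR Bg.1
  set reps := dgroupDK lo hi n (tagRep (Bg.1.reps.zip (blockRowsZ Bg.1)))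
  set bas := dgroupDK lo hi n (wflatZ (Bg.2.zip (blockRowsZ Bg.1)))
  set Mo := tabAbsBound reps (tabAbsBound bas 1)
  have hy' : y.1.length = n ∧ ∀ x ∈ y.1, -Mo ≤ x ∧ x < Mo := dgroupDK_spec Mo (tabAbsBound bas 1) le_rfl hy
  have hbas : ∀ x ∈ bas, x.1.length = n ∧ ∀ z ∈ x.1, -Mo ≤ z ∧ z < Mo :=
    fun x hx => dgroupDK_spec Mo 1 (le_tabAbsBound reps _) hx
  exact rowFastFηκP_eq S lo hi _ Mo n (tabBits_spec n Mo) y hy' bas hbas _ T P₂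

/-- **THE BRIDGE: the ηκ enumerator IS the E-class enumerator of record `shareRFastMFηDKP`** (list equality; no hypothesis). -/
theorem shareRFastMFηκKP_eq (S : MomSpec M) (K : SymCertR) (gbs : List (List QPoly)) (hm : MomTable M) (κ₂ : Word → ℕ)
    (lo hi : ℤ × ℤ) (J L i f : ℕ) :
    shareRFastMFηκKP S K gbs hm κ₂ lo hi J L i f = shareRFastMFηDKP S K gbs hm κ₂ lo hi J L i f := by
  unfold shareRFastMFηκKP shareRFastMFηDKP
  simp only [shareRWithMFηκKP_eq]

/-- **CLOSING on the ηκ enumerator** (binder list = `energyDensity_ge_of_outroutePMFηDKP`'s EXACTLY): per module `m < J·L` one file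
`out_m : PackedNF.pisZero (PackedNF.pcanonNFZHBZ lo hi oP (shareRFastMFηκKP Sm K (K.gramR.map genBasis) hm κ₂ lo hi J L (m / L)
(m % L))) = true := by native_decide`. -/
theorem energyDensity_ge_of_outroutePMFηκKP {Mo : Type} [DecidableEq Mo] [Hashable Mo] (Sm : MomSpec Mo) (K : SymCertR)
    (hwf : wellFormed K.expand = true) (hRok : K.gramR.all (gramBlockROK K.frame) = true)
    (oP : PackedNF.PWord → PackedNF.PHint) (hm : MomTable Mo) (κ₂ : Word → ℕ) (J L : ℕ) (hJ : 0 < J) (hL : 0 < L)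
    (lo hi : ℤ × ℤ) (hbox : boxLicence K.frame lo hi = true) (hcov : coverM Sm K (K.gramR.map genBasis) hm = true)
    (hC : intCoefOK K (K.gramR.map genBasis) = true)
    (hfacts : ∀ m, m < J * L → PackedNF.pisZero (PackedNF.pcanonNFZHBZ lo hi oP
      (shareRFastMFηκKP Sm K (K.gramR.map genBasis) hm κ₂ lo hi J L (m / L) (m % L))) = true) :
    ((symValueR K : ℚ) : ℝ) ≤ energyDensityTT' 1 0 8 (7 / 8) :=
  energyDensity_ge_of_outroutePMFηDKP Sm K hwf hRok oP hm κ₂ J L hJ hL lo hi hbox hcov hC fun m hm' => by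
    rw [← shareRFastMFηκKP_eq Sm K _ hm κ₂ lo hi]; exact hfacts m hm'

end EtaKron

end Summit.Ventures.CertifiedManyBodySolver.Theorems.SymReplay
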